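import Summits.BirchSwinnertonDyer.BirchSwinnertonDyer.Theorems.EisensteinPrimesMazurMCOnCellBTwistbackLamOneRankOne
import Summits.BirchSwinnertonDyer.BirchSwinnertonDyer.Theorems.EisensteinPrimesMazurMCOnCellBTwistbackDisplay5568g1
import HarnessLib

/-!
# Crux 3 `MazurMCOnCellB` (stmt-BirchSwinnertonDyer-19033), line `twistback` v4 — road (d′), PER PAIR:
# Mazur's main conjecture at a non-split X2b pair from STEP L at ONE Heegner datum and the two-engine certificate
# `(μ_an, λ_an) = (0, 1)` of ONE admissible twist — the twist's analytic rank `hrd` is no longer an input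

Width seat bsd-line-x2-p1-w5 (g0), 2026-08-28; sequel of `…TwistbackLamOneRankOne` (p649897, road (d′) core). HONEST
FRAMING (cell `bsd-eis`, run/shared/lean/pub/bsd-eis/): conditional theorems only. Named facts BY NAME: the route's
`PublishedInputs` (stmt-…-19037), Disegni 2020 Thm. 4(1) (`padicBSD_rankOne_nonsplitMult`, PUB), Dokchitser–Dokchitser 2010
Thm. 1.4 (`selmerCorank_mod_two_eq`, PUB), Keller–Yin 2024 Thm. E multiplicative half (`thmE_pConverse_semistable_OPEN`,
UNREFEREED PREPRINT resting on Castella arXiv:2409.01360; every theorem below is conditional on it — the line already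
carries Keller–Yin Thm. D, PRE, inside STEP L). No `def`, no `sorry`; no main conjecture / BSD proved for any curve
unconditionally; 0 cells / labels / stubs / tiers move.

WHAT. LEAD g9's per-pair door p642512 §5
`…TwistbackOnePartnerCertificates.mazurMainConjectureAt_of_cellB_of_not_split_of_indexLowerBoundAt_of_lamMin_twist`
reads: Mazur's MC at a non-split X2b pair `(W, p)` ⟸ STEP L at ONE Heegner datum (`hlow`) + ONE admissible `K` + a
minimal model `Wd` of `E^{(d_K)}` with `hrd : r_an(Wd) = 1` and the two finite checks `(μ_an, λ_an)(Wd, p) = (0, 1)`.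
§1 removes `hrd`: `Wd` is non-split multiplicative at `p` with `E[p]` reducible (transport from `W`), `r_an(Wd) =
r_an(E^{(d_K)})` is odd (`r_an(E) = 0`, Heegner sign), so `(0, 1)` + Dokchitser + Keller–Yin Thm. E give `r_an(Wd) = 1`
(p649897 §3). §2 instantiates §1 on the census cell `(5568g1, 3)` through lam-a g16's display p648214
(`…TwistbackDisplay5568g1`): its instrument reading `hrd : r_an(5568g1 ⊗ χ_{−23}) = 1` (PARI `ellanalyticrank`)
DISAPPEARS — the cell reads «Keller–Yin Thm. D datum + Keller–Yin Thm. E + THREE readings (`r_an(E) = 0`, `N = 5568`,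
`(μ_an, λ_an)(Wd, 3) = (0, 1)`)».

References: [GreenbergVatsal2000] p. 4, Thm. (1.3); [Disegni2020] Thm. 4; [SteinWuthrich2013] Thm. 6.1; [Wuthrich2014]
Thm. 16; [JetchevSkinnerWan2017] §7.4.1; [DokchitserDokchitserAnnals2010] Thm. 1.4; [KellerYin2024] Thm. E (PRE);
Cremona `ecdata` class 5568g.
-/

set_option autoImplicit false

-- `Summit.BirchSwinnertonDyer.BirchSwinnertonDyer.…`: the summit and its single sub-problem share a name.
set_option linter.dupNamespace false

noncomputable section

open scoped Classical MatrixGroups ModularForm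

open CongruenceSubgroup WeierstrassCurve NumberField IsDedekindDomain Field
  Literature.NumberTheory.EllipticCurves
  Literature.NumberTheory.GaloisRepresentations
  Literature.NumberTheory.EllipticCurves.ModularForms
  Literature.NumberTheory.EllipticCurves.Rank1Residual
  Literature.NumberTheory.EllipticCurves.Rank1Residual.Typed
  Literature.NumberTheory.EllipticCurves.Disegni2020
  Literature.NumberTheory.EllipticCurves.KellerYin2024
  Summit.BirchSwinnertonDyer.Rank1Residual
  Summit.BirchSwinnertonDyer.Rank1Residual.X2
  Summit.BirchSwinnertonDyer.Rank1Residual.X2.RouteGSplitDisplay5568g1Local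
  Summit.BirchSwinnertonDyer.BirchSwinnertonDyer.Theses
  Summit.BirchSwinnertonDyer.BirchSwinnertonDyer.Theorems.EisensteinPrimesMazurMCOnCellBTwistbackOnePartnerCertificates
  Summit.BirchSwinnertonDyer.BirchSwinnertonDyer.Theorems.EisensteinPrimesMazurMCOnCellBTwistbackLamOneRankOne
  Summit.BirchSwinnertonDyer.BirchSwinnertonDyer.Theorems.EisensteinPrimesMazurMCOnCellBTwistbackDisplay5568g1

namespace Summit.BirchSwinnertonDyer.BirchSwinnertonDyer.Theorems.EisensteinPrimesMazurMCOnCellBTwistbackLamOneMazurMC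

/-! ## §1. PER PAIR, NON-SPLIT X2b: Mazur's MC from STEP L and `(μ_an, λ_an)(Wd, p) = (0, 1)` — no `hrd` -/

/-- **PER PAIR, NON-SPLIT, two-engine form WITHOUT the analytic rank of the partner**: p642512 §5
`mazurMainConjectureAt_of_cellB_of_not_split_of_indexLowerBoundAt_of_lamMin_twist` VERBATIM with its hypothesis
`hrd : Wd.analyticRank = 1` REMOVED and two named facts added — `hDD : selmerCorank_mod_two_eq Wd p` (Dokchitser–Dokchitser
Thm. 1.4, PUB) and `hKY : KellerYin2024.thmE_pConverse_semistable_OPEN` (PRE). The twist `Wd` is multiplicative NON-split at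
`p` with `E[p]` reducible (`X2.classX2_twist`, `p` splits in `K`); `r_an(Wd) = r_an(E^{(d_K)})` is odd because `r_an(E) = 0`
and `ord_{s=1} L(E/K, s)` is odd under the Heegner hypothesis (p649897 `odd_analyticRank_quadraticTwist_of_analyticRank_eq_zero`,
modularity only); then p649897 §3 (`(0,1)` ⟹ corank `Sel_{p^∞}(Wd/ℚ) = 1` ⟹ `r_an(Wd) = 1`) supplies `hrd`. Inputs by name:
`PublishedInputs`, Disegni Thm. 4(1), Dokchitser; per pair STEP L (`hlow`), `hμ0`, `hlam`; Keller–Yin Thm. E (PRE).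
[claim: KellerYin2024, status: under-review] [cite: DokchitserDokchitserAnnals2010, Thm. 1.4]
[cite: GreenbergVatsal2000, p. 4 (λ-invariants) and Thm. (1.3)] [cite: Disegni2020, Thm. 4 (§3.2)]
[cite: SteinWuthrich2013, Thm. 6.1 (p. 20), §4.2] [cite: Wuthrich2014, Thm. 16 (p. 397)] [cite: JetchevSkinnerWan2017, §7.4.1] -/
theorem mazurMainConjectureAt_of_cellB_of_not_split_of_indexLowerBoundAt_of_lamMin_twist_of_thmE
    (hP : EisensteinPrimes.PublishedInputs) (hDis : padicBSD_rankOne_nonsplitMult)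
    (hKY : thmE_pConverse_semistable_OPEN)
    (W : WeierstrassCurve ℚ) [W.IsElliptic] [W.IsGloballyMinimal] (p : ℕ) [Fact p.Prime]
    (hc : X2.CellB W p) (hns : ¬ W.HasSplitMultiplicativeReductionAtPrime p)
    (N : ℕ) [NeZero N] (K : Type) [Field K] [NumberField K]
    (Dt : ModularParametrizationData W N) (H : HeegnerDatum N (NumberField.discr K)) (ι : K →+* ℂ)
    (P : (W.baseChange K).toAffine.Point)
    (hK : IsImaginaryQuadratic K) (hodd : Odd (NumberField.discr K)) (hlt : NumberField.discr K < -4)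
    (hN : W.conductorNorm ℤ = N) (hHN : SatisfiesHeegnerHypothesis N K)
    (hHp : SatisfiesHeegnerHypothesis p K)
    (hPt : WeierstrassCurve.Affine.Point.map ι.toRatAlgHom P = heegnerPointComplex Dt H)
    (hcM : ¬ (p : ℤ) ∣ Dt.c)
    (Wd : WeierstrassCurve ℚ) [Wd.IsElliptic] [Wd.IsGloballyMinimal]
    (hWd : ∃ C : VariableChange ℚ, C • Wd = W.quadraticTwist (NumberField.discr K : ℚ))
    (hDD : selmerCorank_mod_two_eq Wd p)
    (hlow : Finite (W.baseChange K).sha → X11b.IndexLowerBoundAt W p K P)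
    (hμ0 : X2.AnalyticMuLE Wd p 0) (hlam : X2.AnalyticLambdaEq Wd p 1) :
    X2.MazurMainConjectureAt W p := by
  have hpar := hP.2.2.2.2.1
  have hnf := hP.2.2.2.2.2.1
  have hWu := hP.2.2.2.2.2.2.2.2.2.2.2.2.2.2.1
  have hp2 : p ≠ 2 := hc.2.1.1
  have hmult : W.HasMultiplicativeReductionAtPrime p := hc.2.1.2.2
  have hr0 : W.analyticRank = 0 := hc.1
  obtain ⟨C, hC⟩ := hWd
  -- the twist is X2, NON-split at `p`
  have hXd : ClassX2 Wd p := X2.classX2_twist W p hc.2.1 K hK hHp Wd ⟨C, hC⟩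
  have hnsd : ¬ Wd.HasSplitMultiplicativeReductionAtPrime p := fun hs ↦
    hns ((X2.hasSplitMultiplicativeReductionAtPrime_iff_of_smul_eq_quadraticTwist W Wd hK p hp2 hmult hHp
      hC).mp hs)
  -- its analytic rank is odd (`r_an(E) = 0`, Heegner sign)
  have hHW : SatisfiesHeegnerHypothesis (W.conductorNorm ℤ) K := by rw [hN]; exact hHN
  have hoddd : Odd Wd.analyticRank := by
    have h := congrArg WeierstrassCurve.analyticRank hC
    rw [analyticRank_smul] at h
    rw [h]
    exact EisensteinPrimesMazurMCOnCellBTwistbackLamOneRankOne.odd_analyticRank_quadraticTwist_of_analyticRank_eq_zero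
      hnf W hr0 K hK hHW
  -- road (d′) core: `(0,1)` ⟹ `r_an(Wd) = 1`
  have hrd : Wd.analyticRank = 1 :=
    EisensteinPrimesMazurMCOnCellBTwistbackLamOneRankOne.analyticRank_eq_one_of_analyticLambdaEq_one_of_odd hWu hpar
      hKY Wd p hDD hp2 hXd.2.2 hnsd hXd.2.1 hoddd hμ0 hlam
  exact EisensteinPrimesMazurMCOnCellBTwistbackOnePartnerCertificates.mazurMainConjectureAt_of_cellB_of_not_split_of_indexLowerBoundAt_of_lamMin_twist
    hP hDis W p hc hns N K Dt H ι P hK hodd hlt hN hHN hHp hPt hcM Wd ⟨C, hC⟩ hrd hlow hμ0 hlam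

/-! ## §2. The census cell `(5568g1, 3)`: the analytic-rank reading of the partner disappears -/

/-- **PER-PAIR DISPLAY without the partner's rank reading: `X2.MazurMainConjectureAt (5568g1) 3`** — lam-a g16's p648214
`…TwistbackDisplay5568g1.mazurMainConjectureAt_5568g1_at_three_of_partner23` VERBATIM with the instrument reading
`hrd : r_an(Wd) = 1` (`Wd = 5568g1 ⊗ χ_{−23} = [0, −1, 0, −260844257, −7644351037599]`) REPLACED by the two named facts
`hDD : selmerCorank_mod_two_eq Wd 3` (PUB) and `hKY` (Keller–Yin Thm. E, PRE): from, BY NAME, the route's `PublishedInputs`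
and Disegni 2020 Thm. 4(1); PER PAIR the Heegner datum over a quadratic field `K` with `d_K = −23` (`Dt`, `H`, `ι`, `P`,
`hPt`, `hcM`), STEP L at that datum (`hlow` ⇐ Keller–Yin Thm. D [PRE] + PUB), and THREE readings — `hr` (`r_an(5568g1) = 0`),
`hN` (`N = 5568`) and the two-engine certificate `hμ0`/`hlam` (`(μ_an, λ_an)(Wd, 3) = (0, 1)`, PREDICTED `(0, c(E)) =
(0, 1)` by the Greenberg–Vatsal λ-formula and READ by two engines, kit j311944 / j312229). Nothing booked; `(5568g1, 3)`
stays OPEN; MC / BSD proved for no curve unconditionally. [claim: KellerYin2024, status: under-review]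
[cite: DokchitserDokchitserAnnals2010, Thm. 1.4] [cite: GreenbergVatsal2000, Thm. (1.3) with pp. 14–15, p. 4]
[cite: Disegni2020, Thm. 4 (§3.2)] [cite: SteinWuthrich2013, Thm. 6.1 (p. 20), §4.2] [cite: Wuthrich2014, Thm. 16 (p. 397)]
[cite: JetchevSkinnerWan2017, §7.4.1] -/
theorem mazurMainConjectureAt_5568g1_at_three_of_partner23_of_thmE
    (hP : EisensteinPrimes.PublishedInputs) (hDis : padicBSD_rankOne_nonsplitMult)
    (hKY : thmE_pConverse_semistable_OPEN)
    (W : WeierstrassCurve ℚ) [W.IsElliptic] [W.IsGloballyMinimal] (hW : W = ⟨0, -1, 0, -493089, 628457121⟩)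
    (hr : W.analyticRank = 0)
    (K : Type) [Field K] [NumberField K] (h2 : Module.finrank ℚ K = 2) (hdK : NumberField.discr K = -23)
    (Dt : ModularParametrizationData W 5568) (H : HeegnerDatum 5568 (NumberField.discr K)) (ι : K →+* ℂ)
    (P : (W.baseChange K).toAffine.Point) (hN : W.conductorNorm ℤ = 5568)
    (hPt : WeierstrassCurve.Affine.Point.map ι.toRatAlgHom P = heegnerPointComplex Dt H)
    (hcM : ¬ ((3 : ℕ) : ℤ) ∣ Dt.c)
    (Wd : WeierstrassCurve ℚ) [Wd.IsElliptic] [Wd.IsGloballyMinimal]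
    (hWd : Wd = ⟨0, -1, 0, -260844257, -7644351037599⟩) (hDD : selmerCorank_mod_two_eq Wd 3)
    (hlow : Finite (W.baseChange K).sha → X11b.IndexLowerBoundAt W 3 K P)
    (hμ0 : X2.AnalyticMuLE Wd 3 0) (hlam : X2.AnalyticLambdaEq Wd 3 1) :
    X2.MazurMainConjectureAt W 3 := by
  subst hW hWd
  have hK : IsImaginaryQuadratic K := isImaginaryQuadratic_of_discr_eq_of_neg h2 hdK (by norm_num)
  have hodd : Odd (NumberField.discr K) := by rw [hdK]; exact ⟨-12, by norm_num⟩
  have hlt : NumberField.discr K < -4 := by rw [hdK]; norm_num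
  have hWd' : ∃ C : VariableChange ℚ, C • (⟨0, -1, 0, -260844257, -7644351037599⟩ : WeierstrassCurve ℚ) =
      (⟨0, -1, 0, -493089, 628457121⟩ : WeierstrassCurve ℚ).quadraticTwist (NumberField.discr K : ℚ) := by
    rw [hdK]; exact EisensteinPrimesMazurMCOnCellBTwistbackDisplay5568g1.exists_variableChange_twist23
  exact mazurMainConjectureAt_of_cellB_of_not_split_of_indexLowerBoundAt_of_lamMin_twist_of_thmE hP hDis hKY _ 3
    (EisensteinPrimesMazurMCOnCellBTwistbackDisplay5568g1.cellB_5568g1_of_analyticRank hr) nonsplit_5568g1.2 5568 K Dt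
    H ι P hK hodd hlt hN (EisensteinPrimesMazurMCOnCellBTwistbackDisplay5568g1.satisfiesHeegnerHypothesis_5568 h2 hdK)
    (EisensteinPrimesMazurMCOnCellBTwistbackDisplay5568g1.satisfiesHeegnerHypothesis_3 h2 hdK) hPt hcM _ hWd' hDD hlow
    hμ0 hlam

end Summit.BirchSwinnertonDyer.BirchSwinnertonDyer.Theorems.EisensteinPrimesMazurMCOnCellBTwistbackLamOneMazurMC

end
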